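import Literature.AlgebraicGeometry.Frobenioids.QuasiTemperoidOrbits
import Literature.AlgebraicGeometry.Frobenioids.QuasiTemperoidConnectedPart
import Literature.AlgebraicGeometry.Frobenioids.QuasiTemperoidPushforward
import Literature.AlgebraicGeometry.Frobenioids.QuasiTemperoidInductionFunctor
import Mathlib.FieldTheory.KrullTopology
import Mathlib.FieldTheory.Minpoly.Field
import HarnessLib

/-!
# Frobenioids II, Example 1.3 (iii): the functor `B^temp(Π, Π°)⁰ → B^temp(G_F)⁰`

Mochizuki, *The geometry of Frobenioids II*, Kyushu J. Math. **62** (2008) 401–460, §1 Example 1.3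
(iii), author's text pp. 11–12 [cite: MochizukiFrdII2008, Ex 1.3 (iii) pp.11-12]: "any open homomorphism
`Π → Q` from a tempered topological group `Π`, equipped with an open subgroup `Π° ⊆ Π`, to a quotient
`G_F ↠ Q` of the absolute Galois group `G_F` of `F` determines a functor
`B^temp(Π, Π°)⁰ ↪ B^temp(Π)⁰ → B^temp(Q)⁰ ↪ B^temp(G_F)⁰` [where the middle arrow is a functor as in (ii)]
between connected, totally epimorphic categories of FSM-type."

This file CONSTRUCTS that functor and discharges the named fact `QuasiTemperoid.GaloisBaseFunctor` of
`QuasiTemperoid.lean` (seat abc-iut-L1-t4) with it as the witness: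

* `galois_finite_quotient_of_isOpen` — open subgroups of `Gal(L/K)` (Krull topology, any field extension)
  have finite index: an open subgroup contains the fixing subgroup of a finite-dimensional `E`, whose cosets
  inject into the finite set `Hom_K(E, L)`; hence (`countable_quotient_of_quotientMap`) the open subgroups of
  any quotient `G_F ↠ Q` have countable index — the hypothesis under which the induction of
  `QuasiTemperoidInductionFunctor.lean` lands in `B^temp(Q)` (Mathlib records compactness of `Gal(L/K)` only for
  Galois `L/K`, so we do not go through compactness of `G_F`);
* `relInclusion` — `B^temp(Π, Π°)⁰ ↪ B^temp(Π)⁰` (connected objects of the full subcategory are single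
  orbits, seat abc-iut-L6-t8's `QuasiTemperoidOrbits.lean`, hence connected in `B^temp(Π)`);
* `galoisBaseFunctor` — the composite `relInclusion ⋙ φ_* ⋙ π^*` with `φ_* = inductionFunctorConnected φ`
  (`QuasiTemperoidInductionFunctor.lean`) and `π^*` the pull-back along `π : G_F ↠ Q` on connected objects
  (`pullback`, `QuasiTemperoidPushforward.lean`);
* `galoisBaseFunctor_holds : GaloisBaseFunctor F` — functor conjunct witnessed by `galoisBaseFunctor`, the
  three properties of `B^temp(G_F)⁰` by `QuasiTemperoidConnectedPart.lean`.

RQ7 finding T4-F3 (abc-iut-L6-t20) on the typed statement stands as a remark on its SHAPE (the `Nonempty`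
conjunct does not pin the functor); the discharge below nevertheless uses the printed functor. No
statement of the paper is strengthened.
-/

open CategoryTheory CategoryTheory.Limits Topology
open Literature.AnabelianGeometry.SemiGraphs

namespace Literature.AlgebraicGeometry.Frobenioids

namespace QuasiTemperoid

universe u

/-! ### Open subgroups of Galois groups have finite index -/

section Galois

variable (K L : Type u) [Field K] [Field L] [Algebra K L]

/-- In `Gal(L/K)` with the Krull topology, the fixing subgroup of a finite-dimensional intermediate field
`E` has finite index: `σ ↦ σ|_E` identifies its left cosets with a subset of the finite set `Hom_K(E, L)`.
[cite: MochizukiFrdII2008, Ex 1.3 (iii) pp.11-12] -/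
theorem galois_finite_quotient_fixingSubgroup (E : IntermediateField K L) [FiniteDimensional K E] :
    Finite ((L ≃ₐ[K] L) ⧸ E.fixingSubgroup) := by
  classical
  let ψ : (L ≃ₐ[K] L) ⧸ E.fixingSubgroup → (E →ₐ[K] L) := fun c =>
    Quotient.liftOn' c (fun σ => σ.toAlgHom.comp E.val) fun σ τ hστ => by
      rw [QuotientGroup.leftRel_apply, IntermediateField.mem_fixingSubgroup_iff] at hστ
      ext x
      have hx := hστ x x.2
      rw [AlgEquiv.mul_apply, AlgEquiv.aut_inv, AlgEquiv.symm_apply_eq] at hx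
      change σ x = τ x
      exact hx.symm
  refine Finite.of_injective ψ fun c₁ c₂ h => ?_
  induction c₁ using Quotient.ind with
  | _ σ =>
    induction c₂ using Quotient.ind with
    | _ τ =>
      apply Quotient.sound
      refine QuotientGroup.leftRel_apply.mpr ?_
      rw [IntermediateField.mem_fixingSubgroup_iff]
      intro x hx
      have hστ : σ x = τ x := by
        have := congrArg (fun f : E →ₐ[K] L => f ⟨x, hx⟩) h
        exact this
      rw [AlgEquiv.mul_apply, AlgEquiv.aut_inv, AlgEquiv.symm_apply_eq]
      exact hστ.symm

/-- Open subgroups of `Gal(L/K)` (Krull topology; any field extension `L/K`) have finite index: an open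
subgroup is a neighbourhood of `1`, so contains the fixing subgroup of some finite-dimensional `E`
(`krullTopology_mem_nhds_one_iff`). For `L` an algebraic closure this is "`G_F` is profinite" as far as
Ex. 1.3 (iii) needs it. [cite: MochizukiFrdII2008, Ex 1.3 (iii) pp.11-12] -/
theorem galois_finite_quotient_of_isOpen (U : Subgroup (L ≃ₐ[K] L)) (hU : IsOpen (U : Set (L ≃ₐ[K] L))) :
    Finite ((L ≃ₐ[K] L) ⧸ U) := by
  obtain ⟨E, hE, hEU⟩ := (krullTopology_mem_nhds_one_iff K L U).1 (hU.mem_nhds U.one_mem)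
  haveI := hE
  haveI := galois_finite_quotient_fixingSubgroup K L E
  have hle : E.fixingSubgroup ≤ U := fun σ hσ => hEU hσ
  exact Finite.of_surjective (Subgroup.quotientMapOfLE hle) fun c => by
    induction c using Quotient.ind with
    | _ σ => exact ⟨(σ : (L ≃ₐ[K] L) ⧸ E.fixingSubgroup), rfl⟩

end Galois

section Quotients

variable {Γ : Type u} [Group Γ] [TopologicalSpace Γ] {Q : Type u} [Group Q] [TopologicalSpace Q]

/-- If the open subgroups of `Γ` have finite index and `π : Γ → Q` is a continuous surjective
homomorphism, the open subgroups of `Q` have countable (indeed finite) index: the cosets of `U` are the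
images of the cosets of `π⁻¹(U)`. [cite: MochizukiFrdII2008, Ex 1.3 (iii) pp.11-12] -/
theorem countable_quotient_of_surjective (hΓ : ∀ V : Subgroup Γ, IsOpen (V : Set Γ) → Finite (Γ ⧸ V))
    (π : Γ →* Q) (hc : Continuous π) (hs : Function.Surjective π) (U : Subgroup Q) (hU : IsOpen (U : Set Q)) :
    Countable (Q ⧸ U) := by
  haveI := hΓ (U.comap π) (hU.preimage hc)
  let f : Γ ⧸ U.comap π → Q ⧸ U := fun c =>
    Quotient.liftOn' c (fun γ => ((π γ : Q) : Q ⧸ U)) fun a b hab => by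
      apply Quotient.sound
      rw [QuotientGroup.leftRel_apply] at hab
      refine QuotientGroup.leftRel_apply.mpr ?_
      rw [Subgroup.mem_comap, map_mul, map_inv] at hab
      exact hab
  refine Function.Surjective.countable (f := f) fun c => ?_
  induction c using Quotient.ind with
  | _ q =>
    obtain ⟨γ, rfl⟩ := hs q
    exact ⟨(γ : Γ ⧸ U.comap π), rfl⟩

end Quotients

/-- Open subgroups of a quotient `π : G_F ↠ Q` of the absolute Galois group of a field `F` have countable
index (Ex. 1.3 (iii): `Q` "a quotient `G_F ↠ Q` of the absolute Galois group").
[cite: MochizukiFrdII2008, Ex 1.3 (iii) pp.11-12] -/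
theorem countable_quotient_of_absoluteGaloisGroup (F : Type u) [Field F] {Q : Type u} [Group Q]
    [TopologicalSpace Q] (π : Field.absoluteGaloisGroup F →* Q) (hc : Continuous π)
    (hs : Function.Surjective π) (U : Subgroup Q) (hU : IsOpen (U : Set Q)) : Countable (Q ⧸ U) :=
  countable_quotient_of_surjective
    (fun V hV => galois_finite_quotient_of_isOpen F (AlgebraicClosure F) V hV) π hc hs U hU

/-! ### `B^temp(Π, Π°)⁰ ↪ B^temp(Π)⁰` -/

section Rel

variable (G : Type u) [Group G] [TopologicalSpace G] (H : Subgroup G)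

/-- A connected object of `B^temp(Π, Π°)` is connected in `B^temp(Π)`: both mean "a single orbit"
(`QuasiTemperoidOrbits.lean` for `B^temp(Π, Π°)`, `QuasiTemperoidConnected.lean` for `B^temp(Π)`).
[cite: MochizukiFrdII2008, Ex 1.3 (iii) pp.11-12] -/
theorem isConnectedObj_obj_of_rel (T : BTempRel G H) (hT : IsConnectedObj T) : IsConnectedObj T.obj := by
  obtain ⟨x₀⟩ := BTempRel.nonempty_of_isConnectedObj T hT
  exact BTempConnected.isConnectedObj_of_transitive T.obj x₀ (BTempRel.exists_ρ_eq_of_isConnectedObj T hT x₀)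

/-- The first arrow `B^temp(Π, Π°)⁰ ↪ B^temp(Π)⁰` of Ex. 1.3 (iii) (FrdII p. 11): the full inclusion on
connected objects. [cite: MochizukiFrdII2008, Ex 1.3 (iii) pp.11-12] -/
def relInclusion : ConnectedPart (BTempRel G H) ⥤ ConnectedPart (BTemp G) :=
  (connectedObjects (BTemp G)).lift ((connectedObjects (BTempRel G H)).ι ⋙ (admitsHomToCoset G H).ι)
    fun T => isConnectedObj_obj_of_rel G H T.obj T.property

end Rel

/-! ### The functor of Example 1.3 (iii) and the named fact -/

section Main

variable (F : Type u) [Field F]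

/-- **Example 1.3 (iii)** (FrdII pp. 11–12), the functor itself:
`B^temp(Π, Π°)⁰ ↪ B^temp(Π)⁰ →(φ_*) B^temp(Q)⁰ →(π^*) B^temp(G_F)⁰` for an open homomorphism `φ : Π → Q`
to a quotient `π : G_F ↠ Q` of `G_F = Field.absoluteGaloisGroup F` — inclusion, then induction along `φ`
(`inductionFunctorConnected`; it lands in `B^temp(Q)` because open subgroups of `Q` have countable index), then
pull-back along `π` (`pullback`). Answers the "functor not pinned" point of the audit of the named fact.
[cite: MochizukiFrdII2008, Ex 1.3 (iii) pp.11-12] -/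
noncomputable def galoisBaseFunctor (G : Type u) [Group G] [TopologicalSpace G] (H : Subgroup G)
    (Q : Type u) [Group Q] [TopologicalSpace Q] [IsTopologicalGroup Q]
    (φ : G →* Q) (π : Field.absoluteGaloisGroup F →* Q)
    (hφ : IsOpenHom φ) (hc : Continuous π) (hs : Function.Surjective π) :
    ConnectedPart (BTempRel G H) ⥤ ConnectedPart (BTemp (Field.absoluteGaloisGroup F)) :=
  relInclusion G H ⋙ inductionFunctorConnected φ hφ.isOpenMap (countable_quotient_of_absoluteGaloisGroup F π hc hs) ⋙
    pullback π hs hc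

/-- **[FrdII] Example 1.3 (iii)** discharged: the named fact `QuasiTemperoid.GaloisBaseFunctor F` — the
functor conjunct witnessed by the printed composite `galoisBaseFunctor`, and `B^temp(G_F)⁰` connected,
totally epimorphic and of FSM-type (`QuasiTemperoidConnectedPart.lean`, valid for any topological group).
[cite: MochizukiFrdII2008, Ex 1.3 (iii) pp.11-12] -/
theorem galoisBaseFunctor_holds : GaloisBaseFunctor F := by
  intro G _ _ _ H Q _ _ _ φ π _ _ hφ hc hs
  exact ⟨⟨galoisBaseFunctor F G H Q φ π hφ hc hs⟩, BTempConnected.galoisBase_isConnected F,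
    BTempConnected.galoisBase_isTotallyEpimorphic F, BTempConnected.galoisBase_isOfFSMType F⟩

/-- `GaloisBaseFunctor` — `_holds` alias of `galoisBaseFunctor_holds` above under the fact's exact name (appended
2026-08-28, D-0026 bookkeeping: the proof term is the existing theorem of this file; no statement,
definition or attribute is edited; no new named fact; the ledger's debt table listed the fact
unproved). [cite: MochizukiFrdII2008, Ex 1.3 (iii) pp.11-12] -/
theorem _root_.Literature.AlgebraicGeometry.Frobenioids.QuasiTemperoid.GaloisBaseFunctor_holds :
    GaloisBaseFunctor F :=
  _root_.Literature.AlgebraicGeometry.Frobenioids.QuasiTemperoid.galoisBaseFunctor_holds (F := F)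

end Main

end QuasiTemperoid

end Literature.AlgebraicGeometry.Frobenioids
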